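import Summits.ValiantsHypothesis.ValiantsHypothesis.Theorems.MonotoneRestorationOrbitRestorationQPSmallModulesAltSpanning
import HarnessLib

/-!
# Inhomogeneous polynomial catalecticant rank ⇒ quasi-polynomial orbit restoration (unconditional)

Route MonotoneRestoration, crux `OrbitRestorationQP` (stmt-ValiantsHypothesis-18293), line `depth-three-rung`,
stub A_∞ `stub_sigmaPiSigmaValue`.  Namespace `Summit.ValiantsHypothesis.ValiantsHypothesis.Theorems.DerivativeTower`.

`…SmallModulesAltSpanning.lean` made the ΣΛΣ stratum of A_∞ unconditional.  This file records the common
generalisation of its three theorems in one statement, WITHOUT homogeneity: a matrix-symmetric `f` of degree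
`≤ D` all of whose homogeneous components have derivative spaces of dimension `≤ r` ("graded catalecticant
rank `≤ r`") —

* `qpOrbitRestorable_of_smallGradedDerivChain` — per level, modulo the alt-spanning property for dimension
  `≤ r` (the graded alt-supported derivative system of `…DerivativeGraded.lean`, fed by the chains of all
  components);
* `smallGradedDerivChain_restoration` — **UNCONDITIONAL family form with ONE constant for the whole class:
  for every `c` there is `c'` such that every matrix-symmetric family whose homogeneous components have all
  derivative spaces of dimension `≤ n^c + c` satisfies `QPOrbitRestorable c' n (f n)` for all `n`.**

This contains sums of `≤ n^c` powers of affine forms of any degrees, and sums of polynomially many products of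
a BOUNDED number of powers of affine forms.  Honest label: a stratum of stub A_∞; ΣΠΣ with many distinct forms
per product, A_∞, the crux and VP ≠ VNP remain open. [folklore]
-/

noncomputable section

open scoped Classical

-- `Summit.ValiantsHypothesis.ValiantsHypothesis.…` is the tree's single-conjunct layout (Sub = Summit).
set_option linter.dupNamespace false

namespace Summit.ValiantsHypothesis.ValiantsHypothesis.Theorems

namespace DerivativeTower

open MvPolynomial Finset Equiv OrbitRestorationQPDepthThreeRung WaringJennrich LevelStructure

variable {n : ℕ}

/-- **GRADED POLYNOMIAL CATALECTICANT RANK ⇒ ORBIT-RESTORABLE (modulo the alt-spanning property).**  Let `f`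
be matrix-symmetric of total degree `≤ D`, and suppose every derivative space of every homogeneous component of
`f` is finite-dimensional of dimension `≤ r`.  If every finite-dimensional matrix-stable subspace of dimension
`≤ r` is spanned by its members fixed by all even permutations fixing `≤ k` indices pointwise, then
`QPOrbitRestorable (k + 7) n f`. [folklore] -/
theorem qpOrbitRestorable_of_smallGradedDerivChain {k r D : ℕ}
    (hKey : ∀ W : Submodule ℂ (MvPolynomial (Fin n × Fin n) ℂ), FiniteDimensional ℂ W →
      Module.finrank ℂ W ≤ r → (∀ σ τ : Perm (Fin n), ∀ w ∈ W, mact σ τ w ∈ W) →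
        W ≤ Submodule.span ℂ {v | v ∈ W ∧ ∃ Y : Finset (Fin n), Y.card ≤ k ∧
          ∀ ρ : Perm (Fin n), (∀ i ∈ Y, ρ i = i) → Perm.sign ρ = 1 → ren ρ v = v})
    {f : MvPolynomial (Fin n × Fin n) ℂ} (hdeg : f.totalDegree ≤ D)
    (hrank : ∀ e m, FiniteDimensional ℂ (derivChain (homogeneousComponent e f) m) ∧
      Module.finrank ℂ (derivChain (homogeneousComponent e f) m) ≤ r)
    (hsym : ∀ σ τ : Perm (Fin n), mact σ τ f = f) :
    QPOrbitRestorable (k + 7) n f := by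
  set fc : ℕ → MvPolynomial (Fin n × Fin n) ℂ := fun e => homogeneousComponent e f with hfc
  have hfc_sym : ∀ e, ∀ σ τ : Perm (Fin n), mact σ τ (fc e) = fc e := fun e σ τ => by
    rw [hfc]; simp only []; rw [mact_homogeneousComponent, hsym]
  -- alt-supported spanning sets for each component's derivative chain
  have hfin : ∀ e m, ∃ T : Finset (MvPolynomial (Fin n × Fin n) ℂ),
      (∀ t ∈ T, t ∈ derivChain (fc e) m ∧ ∃ Y : Finset (Fin n), Y.card ≤ k ∧
        ∀ ρ : Perm (Fin n), (∀ i ∈ Y, ρ i = i) → Perm.sign ρ = 1 → ren ρ t = t) ∧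
      derivChain (fc e) m ≤ Submodule.span ℂ (T : Set _) := by
    intro e m
    have hrk := hrank e m
    haveI := hrk.1
    have hspan := hKey _ hrk.1 hrk.2 (fun σ τ v hv => mact_mem_derivChain (hfc_sym e) σ τ m hv)
    obtain ⟨S₀, hS₀⟩ := (Submodule.fg_iff_finiteDimensional _).2 hrk.1
    have hch : ∀ s ∈ S₀, ∃ F : Finset (MvPolynomial (Fin n × Fin n) ℂ),
        (↑F : Set _) ⊆ {v | v ∈ derivChain (fc e) m ∧ ∃ Y : Finset (Fin n), Y.card ≤ k ∧
          ∀ ρ : Perm (Fin n), (∀ i ∈ Y, ρ i = i) → Perm.sign ρ = 1 → ren ρ v = v} ∧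
        s ∈ Submodule.span ℂ (F : Set _) := by
      intro s hs
      have hs' : s ∈ derivChain (fc e) m := by rw [← hS₀]; exact Submodule.subset_span hs
      exact Submodule.mem_span_finite_of_mem_span (hspan hs')
    choose F hF using hch
    refine ⟨S₀.attach.biUnion fun s => F s.1 s.2, fun t ht => ?_, ?_⟩
    · obtain ⟨s, -, hts⟩ := Finset.mem_biUnion.mp ht
      exact (hF s.1 s.2).1 hts
    · rw [← hS₀, Submodule.span_le]
      intro s hs
      refine Submodule.span_mono ?_ (hF s hs).2
      intro v hv
      simp only [Finset.coe_biUnion, Finset.coe_attach, Set.mem_univ, Set.iUnion_true, Set.mem_iUnion]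
      exact ⟨⟨s, hs⟩, hv⟩
  choose T hT using hfin
  -- the graded system: values of degree `g` are the levels `e - g` of the chains of `fc e`, `g ≤ e ≤ D`
  let V : ℕ → Finset (MvPolynomial (Fin n × Fin n) ℂ) := fun g =>
    (Finset.range (D + 1)).biUnion fun e => if g ≤ e then T e (e - g) else ∅
  have hVmem : ∀ g t, t ∈ V g ↔ ∃ e, e ≤ D ∧ g ≤ e ∧ t ∈ T e (e - g) := by
    intro g t
    simp only [V, Finset.mem_biUnion, Finset.mem_range]
    constructor
    · rintro ⟨e, he, ht⟩
      by_cases hge : g ≤ e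
      · rw [if_pos hge] at ht; exact ⟨e, by omega, hge, ht⟩
      · rw [if_neg hge] at ht; exact absurd ht (Finset.notMem_empty t)
    · rintro ⟨e, he, hge, ht⟩
      exact ⟨e, by omega, by rw [if_pos hge]; exact ht⟩
  have hhomV : ∀ g, ∀ t ∈ V g, t.IsHomogeneous g := by
    intro g t ht
    obtain ⟨e, -, hge, ht⟩ := (hVmem g t).1 ht
    have h := isHomogeneous_of_mem_derivChain_of_isHomogeneous (homogeneousComponent_isHomogeneous e f)
      (e - g) ((hT e (e - g)).1 t ht).1
    rwa [show e - (e - g) = g by omega] at h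
  have hsuppV : ∀ g, ∀ t ∈ V g, ∃ Y : Finset (Fin n), Y.card ≤ k ∧
      ∀ ρ : Perm (Fin n), (∀ i ∈ Y, ρ i = i) → Perm.sign ρ = 1 → ren ρ t = t := by
    intro g t ht
    obtain ⟨e, -, -, ht⟩ := (hVmem g t).1 ht
    exact ((hT e (e - g)).1 t ht).2
  have hderV : ∀ g, ∀ t ∈ V (g + 1), ∀ x : Fin n × Fin n,
      pderiv x t ∈ Submodule.span ℂ (V g : Set (MvPolynomial (Fin n × Fin n) ℂ)) := by
    intro g t ht x
    obtain ⟨e, he, hge, ht⟩ := (hVmem (g + 1) t).1 ht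
    have h1 : pderiv x t ∈ derivChain (fc e) (e - (g + 1) + 1) :=
      pderiv_mem_derivChain ((hT e (e - (g + 1))).1 t ht).1 x
    rw [show e - (g + 1) + 1 = e - g by omega] at h1
    refine Submodule.span_mono ?_ ((hT e (e - g)).2 h1)
    intro v hv
    exact (hVmem g v).2 ⟨e, he, by omega, hv⟩
  -- `f` is the sum of its components, each a value of the system
  have hfsum : f = ∑ e ∈ Finset.range (D + 1), fc e := by
    conv_lhs => rw [← sum_homogeneousComponent f]
    have hsub : Finset.range (f.totalDegree + 1) ⊆ Finset.range (D + 1) :=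
      fun x hx => Finset.mem_range.2 (by rw [Finset.mem_range] at hx; omega)
    rw [← Finset.sum_subset hsub]
    intro e he hne
    rw [Finset.mem_range] at he hne
    show homogeneousComponent e f = 0
    exact homogeneousComponent_eq_zero e f (by omega)
  have hfspan : f ∈ Submodule.span ℂ (((Finset.range (D + 1)).biUnion V : Finset _) :
      Set (MvPolynomial (Fin n × Fin n) ℂ)) := by
    rw [hfsum]
    refine Submodule.sum_mem _ fun e he => ?_
    rw [Finset.mem_range] at he
    have h0 : fc e ∈ derivChain (fc e) 0 := mem_derivChain_zero _
    refine Submodule.span_mono ?_ ((hT e (e - e)).2 (by rw [Nat.sub_self]; exact h0))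
    intro v hv
    rw [Finset.mem_coe, Finset.mem_biUnion]
    exact ⟨e, Finset.mem_range.2 he, (hVmem e v).2 ⟨e, by omega, le_rfl, hv⟩⟩
  exact DerivativeTowerAlt.qpOrbitRestorable_of_gradedSystem (D := D) V hhomV hsuppV hderV hfspan
    fun σ => by rw [ren_eq_mact]; exact hsym σ σ

/-- **GRADED POLYNOMIAL CATALECTICANT RANK ⇒ QUASI-POLYNOMIAL ORBIT RESTORATION, UNCONDITIONAL, ONE CONSTANT.**
For every `c` there is `c'` such that every matrix-symmetric family `f` all of whose homogeneous components
`homogeneousComponent e (f n)` have every derivative space `derivChain _ m` of dimension `≤ n^c + c` satisfies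
`QPOrbitRestorable c' n (f n)` for every `n`. [folklore] -/
theorem smallGradedDerivChain_restoration (c : ℕ) : ∃ c' : ℕ,
    ∀ f : (n : ℕ) → MvPolynomial (Fin n × Fin n) ℂ, IsMatrixSymmetric f →
      (∀ n e m, FiniteDimensional ℂ (derivChain (homogeneousComponent e (f n)) m) ∧
        Module.finrank ℂ (derivChain (homogeneousComponent e (f n)) m) ≤ n ^ c + c) →
      ∀ n : ℕ, QPOrbitRestorable c' n (f n) := by
  obtain ⟨k, n₀, hk⟩ := AltFix.smallModules_altSpanning c
  refine ⟨n₀.factorial + k + 7, fun f hsym hrank n => ?_⟩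
  by_cases hn : n₀ ≤ n
  · refine Restorable.qpOrbitRestorable_mono (by omega)
      (qpOrbitRestorable_of_smallGradedDerivChain (k := k) (r := n ^ c + c) (D := (f n).totalDegree)
        (fun W hW hdim hst => hk n hn W hW hdim fun ρ w' hw' => by rw [ren_eq_mact]; exact hst ρ ρ w' hw')
        le_rfl (hrank n) fun σ τ => ?_)
    rw [mact_apply]; exact hsym n σ τ
  · refine Restorable.qpOrbitRestorable_mono ?_
      (Restorable.qpOrbitRestorable_of_invariant (f n) fun σ => ValueOrbit.ren_eq_of_matrixSymmetric (hsym n) σ)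
    have : n.factorial ≤ n₀.factorial := Nat.factorial_le (by omega)
    omega

end DerivativeTower

end Summit.ValiantsHypothesis.ValiantsHypothesis.Theorems

end
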